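import Literature.MathematicalPhysics.QuantumFieldTheory.Balaban1983to89.T4SegmentCurvature

/-!
# NE9RelativeChartPlaquette — D-8-abs FROM THE NE9 OWNER'S SIDE: the plaquette variable of a RELATIVE exponential-chart point
# `(exp Cᵢ·Uᵢ, Uᵢ⁻¹·exp(−Cᵢ))` around a unitary background, against print's ABSOLUTE small-field clause (iii) `|∂𝐔 − 1| < α₀ξ²`
# of the complex space `U^c_j(X, α₀, α₁)` — the «elementary inequality» of [I] (3.43) WITH A BACKGROUND, typed and PROVED, the
# budget it costs DISPLAYED in print's letters, and the quadratic member shown SHARP (cell `pub-balaban`, T4-DAG §2 node U3 ∕ §6 NE9;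
# BINDER row NE9 OWNER lineage `b2b-balaban-t4-ne9-p1`, generation 35; substrate-typer ruling (λ8) «D-8-abs … an owner∕NE9 ESTIMATE …
# WANTED-on-display», journal `CLAIMS.log` l.17442; cross-read O-g35-1 INFO-1, l.17295 ∕ l.17434)
# v1.0.1 (gen 36, DOCFIX-LOW C-ne9leaf03g22-1 l.18047: «(4B₃²O(1)M)²α₀ ≤ β» re-read on the ×2 render of p. 278 — v1 had OCR `B₁`; decls unchanged)

HONEST FRAMING (T4-DAG PAGE 1).  Rung (B)+1 of the FINITE-VOLUME T⁴ programme — NOT infinite volume, NOT a mass gap, NOT the Clay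
problem.  NE9 (`T4OutputRate.NE9` ∧ `FadingMemory`) is a cell NEW ESTIMATE, NOT PRINTED in [I] = [Balaban1987RG1] (CMP **109**),
[II] = [Balaban1988RG2Cluster] (CMP **116**), and NOT PROVED for Bałaban's E^{(j)} («NE9 ⇐ the named binders»; 0∕18 leaves instantiated
on Bałaban's objects; spine PROVED 0∕9).  HONEST DEPENDENCY (cell line, verbatim): continuum YM on T⁴ ⇐ BetaPertH ∧ nine spine estimates
(0/9 proved); BetaPertH ⇐ (D1) ∧ (D4) ∧ CAP+tail; G-an2-4 gates asym, D1 and NE2/3/4.  `FlowStep.BetaPertH`, (B), (B^μ) do not occur.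
ELEMENTARY NORMED-ALGEBRA BOOKKEEPING; no object of the series is asserted to satisfy anything; every printed clause below is a LOCUS
(displayed with its page), never a hypothesis discharged about Bałaban's configurations (ABSOLUTE RULE).  0 sorry.

THE QUESTION (substrate MAP §O1 row **D-8-abs**, typer (λ8)).  The substrate's complex chart of record is RELATIVE to a unitary centre:
`SubstrateTransporterSpecies.expChart R⁰ A ν i = exp (A ν i) * R⁰ ν i`, `expChartInv R⁰ A ν i = (R⁰ ν i)⁻¹ * exp (−A ν i)`, balls
`InHoloBallT R⁰ ρ` in the sup norm of the Lie-algebra coordinate `A`.  Print's space is cut out by ABSOLUTE clauses on the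
configuration itself: [I] p. 262 «(i) 𝐔 = U′U, U has values in the group G, |∂U − 1| < α₀ξ² on X, (1.11) … (ii) U′ = exp iξA′, A′
has values in the algebra 𝐠^c, |A′|, |∇^ξ_U A′| < α₁ on X. (1.13) (iii) The configurations 𝐔, 𝐉 satisfy the bounds |∂𝐔 − 1| < α₀ξ²,
|𝐉| < γ₀ on X. (1.14)» plus the tower clause (iv) (1.15)–(1.16).  Clause (ii) IS relative (`𝐔 = e^{iξA′}·U`, i.e. the chart with
`C = iξA′`, amplitude `‖C‖ < ξα₁`); clause (i) concerns the centre; clause (iv) follows from (i)–(iii) at smaller constants (p. 263 ¶2,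
«It is obvious that for α′₀ sufficiently small the above estimates imply the condition (iv)» — a T-row, displayed, not used here).  What a
relative chart does NOT give for free is clause (iii): the plaquette variable of the chart point.  Print meets (iii) for its contour
configurations by «an elementary inequality» ((3.43) p. 278, quadratic in the amplitude, with the restriction «We assume that
(4B₃²O(1)M)²α₀ ≤ β») together with the derivative control (3.44)–(3.46) and the enlargement «(1 + 3β)α₀» of (3.41)∕(3.47).  THIS FILE types
and PROVES that elementary inequality WITH A UNITARY BACKGROUND (the tree's `T4SegmentCurvature` is the background-free, axial-gauge case):

* §1 the words: background plaquette `plaqBg U V = U₁U₂V₃V₄` (`V` = the inverse side), its inverse word `plaqBgInv`, the chart-point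
  plaquette **`holRel U V C = e^{C₁}U₁ · e^{C₂}U₂ · V₃e^{−C₃} · V₄e^{−C₄}`** (literally the product of two `expChart` and two `expChartInv`
  bond values, `holRel_eq_expChart`), the two COVARIANT DIFFERENCES across the plaquette `covDiff₁ = U₄C₃V₄ − C₁`, `covDiff₂ = U₁C₂V₁ − C₄`
  (each is `iξ·ξ∇^ξ_U A′` of (1.13) at the plaquette), the exponents transported to the base point `trExp₁…₄` and the pure-exponential
  word `expWord = e^{c₁}e^{c₂}e^{−c₃}e^{−c₄}`; the ring identity **`trExp_curl`**: `c₁ + c₂ − c₃ − c₄ = (C₁ − PC₁P̄) + (C₄ − PC₄P̄) +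
  covDiff₂ − P·covDiff₁·P̄`;
* §2 THE TRANSPORT IDENTITY **`expWord_mul_plaqBg`**: `holRel = expWord · plaqBg` when `VᵢUᵢ = UᵢVᵢ = 1` (Mathlib `exp_units_conj`);
* §3 THE ESTIMATE **`norm_holRel_sub_one_le`**: for `‖Uᵢ‖, ‖Vᵢ‖ ≤ 1`, `‖Cᵢ‖ ≤ a`, `‖covDiffᵢ‖ ≤ δ`, `‖plaqBg − 1‖ ≤ ε`:
  `‖holRel − 1‖ ≤ ε + 2δ + 4aε + (e^{4a} − 1 − 4a)` — first order in the background's curvature `ε` and in the covariant differences `δ`,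
  QUADRATIC in the amplitude `a` (`T4SegmentCurvature.norm_prod_exp_sub_one_le_first_order` on the transported word);
* §4 IN PRINT'S LETTERS (**the display (λ8) asks for**): `ε = α′₀ξ²` ((1.11) of the centre), `a = ξα₁` ((1.13), amplitude), `δ = ξ²a′`
  ((1.13), covariant difference quotient `a′`), `0 < ξ ≤ 1`, `4α₁ ≤ 1` ⟹ `‖holRel − 1‖ ≤ ξ²·(α′₀(1 + 4ξα₁) + 2a′ + 16α₁²)`
  (`norm_holRel_sub_one_le_xi_sq`), hence clause (iii) `≤ α₀ξ²` under the ONE displayed scalar **`CondIIIBudget α₀ α′₀ α₁ a′ :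
  α′₀(1 + 4α₁) + 2a′ + 16α₁² ≤ α₀`** (`norm_holRel_sub_one_le_of_budget`) — S-class, uniform in `ξ`; its quadratic member is print's
  restriction after (3.43), its linear member the (3.44)–(3.46) derivative control, its first member the (3.41)∕(3.47) enlargement;
* COMPANION `NE9RelativeChartPlaquetteWitness` (same generation): §5 the quadratic member is SHARP (flat commutator witness on `M₂(ℂ)`:
  covariantly constant coordinate, `(holRel − 1)₂₂ = −t²` exactly — NO amplitude-only relative ball of print's radius `ξα₁` lies in clause
  (iii) unless `α₁² ≲ α₀`, the kernel content of «relative ≠ absolute»); §6 the §3 bound on the substrate's `expChart ∕ expChartInv` bond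
  values with the unitarity side conditions DISCHARGED.
CONSEQUENCE FOR ROW NE9 (dictionary, nothing re-typed): NE9's analyticity balls `ball 0 (R X)`, `R X = ρ₀ ∕ lev (scale X)` (Q-S15,
`NE9ChartRadiusExplicit`) are to be read in a chart norm dominating BOTH the amplitude and `lev·`(covariant differences); with that reading
the ball's image satisfies (ii) by inspection and (iii) by §4 under `CondIIIBudget`, so «E^{(j)} defined and analytic on U^c_j(X, α₀, α₁)»
((1.18) p. 263) covers it modulo the T-row (iv); the letter `ρ₀` is a cell letter `≤ α₁` constrained by the budget, NOT print's `α₁`;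
print's Lemma 4 (3.53) p. 280 places the contour configurations in that weighted set by (3.37) + (3.44)–(3.46) + (3.50)–(3.52) (T-rows,
displayed in NE9's `CurData.Admissible.cur_an`, never asserted).
DISGUISE TEST: a normed-algebra inequality about four exponentials and four unitaries; no functional of the series; not NE9, not (B).

References (TYPES ∕ loci only): [Balaban1987RG1] T. Bałaban, CMP **109** (1987) 249–301: (1.11)–(1.16) p. 262, (1.18) p. 263 and ¶2
there, (3.37) p. 277, (3.41)–(3.47) pp. 278–279, (3.50)–(3.53) p. 280; [Balaban1985BackgroundPropagators] T. Bałaban, CMP **99** (1985)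
389–434, Sect. B pp. 399–400 «U′U, U′ = e^{iηA}» (KIND of the chart).  Summits-side NEW work (LEAN PLACEMENT RULE); imports
`T4SegmentCurvature` (the exponential-word bounds, REUSED by name) only; modifies nothing.  Value = the one inequality between the
substrate's relative chart and print's absolute clause, closed in the kernel with its smallness named; NOT summit progress.
-/

noncomputable section
namespace Summit.QuantumFields.BalabanUV.T4Continuum.NE9RelativeChartPlaquette

open NormedSpace
open Literature.MathematicalPhysics.QuantumFieldTheory.Balaban1983to89.T4SegmentCurvature
  (norm_prod_exp_sub_one_le_first_order exp_sub_one_sub_mono)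

/-! ## §1 The words of one plaquette in a relative chart -/

section Words

variable {𝔸 : Type*} [Ring 𝔸]

/-- [folklore] The BACKGROUND PLAQUETTE `P := U₁U₂V₃V₄` of the oriented plaquette `(b₁, b₂, b₃, b₄)` (bonds `b₃, b₄` traversed
backwards; `Vᵢ` the inverse-side variable of bond `bᵢ`). -/
def plaqBg (U V : Fin 4 → 𝔸) : 𝔸 := U 0 * U 1 * V 2 * V 3

/-- [folklore] The INVERSE WORD `P̄ := U₄U₃V₂V₁` of the background plaquette. -/
def plaqBgInv (U V : Fin 4 → 𝔸) : 𝔸 := U 3 * U 2 * V 1 * V 0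

/-- [folklore] FIRST COVARIANT DIFFERENCE across the plaquette: the `μ`-component at `x + ν` transported back along `b₄` minus the
`μ`-component at `x` — `U₄C₃V₄ − C₁` (in print's letters `iξ·ξ(∇^ξ_U A′)`, (1.13)). -/
def covDiff₁ (U V C : Fin 4 → 𝔸) : 𝔸 := U 3 * C 2 * V 3 - C 0

/-- [folklore] SECOND COVARIANT DIFFERENCE across the plaquette: the `ν`-component at `x + μ` transported back along `b₁` minus the
`ν`-component at `x` — `U₁C₂V₁ − C₄`. -/
def covDiff₂ (U V C : Fin 4 → 𝔸) : 𝔸 := U 0 * C 1 * V 0 - C 3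

/-- [folklore] The exponent of bond 1 (at the base point already): `c₁ = C₁`. -/
def trExp₁ (_U _V C : Fin 4 → 𝔸) : 𝔸 := C 0

/-- [folklore] The exponent of bond 2 transported to the base point: `c₂ = U₁C₂V₁`. -/
def trExp₂ (U V C : Fin 4 → 𝔸) : 𝔸 := U 0 * C 1 * V 0

/-- [folklore] The exponent of bond 3 transported to the base point along `b₁b₂b₃⁻¹ = P·b₄`: `c₃ = (PU₄)C₃(V₄P̄)`. -/
def trExp₃ (U V C : Fin 4 → 𝔸) : 𝔸 := plaqBg U V * U 3 * C 2 * (V 3 * plaqBgInv U V)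

/-- [folklore] The exponent of bond 4 transported around the plaquette: `c₄ = PC₄P̄`. -/
def trExp₄ (U V C : Fin 4 → 𝔸) : 𝔸 := plaqBg U V * C 3 * plaqBgInv U V

/-- [folklore] **THE CURL OF THE TRANSPORTED EXPONENTS** (ring identity): `c₁ + c₂ − c₃ − c₄ = (C₁ − PC₁P̄) + (C₄ − PC₄P̄) + covDiff₂ −
P·covDiff₁·P̄` — two `Ad(P) − 1` defects of the background plaquette plus the two covariant differences. -/
theorem trExp_curl (U V C : Fin 4 → 𝔸) :
    trExp₁ U V C + trExp₂ U V C - trExp₃ U V C - trExp₄ U V C =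
      (C 0 - plaqBg U V * C 0 * plaqBgInv U V) + (C 3 - plaqBg U V * C 3 * plaqBgInv U V) + covDiff₂ U V C -
        plaqBg U V * covDiff₁ U V C * plaqBgInv U V := by
  simp only [trExp₁, trExp₂, trExp₃, trExp₄, covDiff₁, covDiff₂]
  noncomm_ring

variable {U V : Fin 4 → 𝔸}

/-- [folklore] `P·P̄ = 1` for two-sided inverses. -/
theorem plaqBg_mul_plaqBgInv (hUV : ∀ i, U i * V i = 1) (hVU : ∀ i, V i * U i = 1) :
    plaqBg U V * plaqBgInv U V = 1 := by
  have hcU : ∀ i (x : 𝔸), U i * (V i * x) = x := fun i x => by rw [← mul_assoc, hUV i, one_mul]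
  have hcV : ∀ i (x : 𝔸), V i * (U i * x) = x := fun i x => by rw [← mul_assoc, hVU i, one_mul]
  simp only [plaqBg, plaqBgInv, mul_assoc, hcU, hcV, hUV]

/-- [folklore] `P̄·P = 1` for two-sided inverses. -/
theorem plaqBgInv_mul_plaqBg (hUV : ∀ i, U i * V i = 1) (hVU : ∀ i, V i * U i = 1) :
    plaqBgInv U V * plaqBg U V = 1 := by
  have hcU : ∀ i (x : 𝔸), U i * (V i * x) = x := fun i x => by rw [← mul_assoc, hUV i, one_mul]
  have hcV : ∀ i (x : 𝔸), V i * (U i * x) = x := fun i x => by rw [← mul_assoc, hVU i, one_mul]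
  simp only [plaqBg, plaqBgInv, mul_assoc, hcU, hcV, hUV]

end Words

section ExpWords

variable {𝔸 : Type*} [Ring 𝔸] [TopologicalSpace 𝔸] [IsTopologicalRing 𝔸]

/-- [folklore] **THE PLAQUETTE VARIABLE OF THE RELATIVE-CHART POINT** `(bᵢ ↦ e^{Cᵢ}Uᵢ)` with inverse side `(bᵢ ↦ Vᵢe^{−Cᵢ})`:
`e^{C₁}U₁ · e^{C₂}U₂ · V₃e^{−C₃} · V₄e^{−C₄}` — the shapes of `SubstrateTransporterSpecies.expChart ∕ expChartInv` (companion §6), KIND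
[Balaban1985BackgroundPropagators] Sect. B «U′U, U′ = e^{iηA}». [cite: Balaban1987RG1, (1.13)-(1.14) p.262] -/
def holRel (U V C : Fin 4 → 𝔸) : 𝔸 :=
  exp (C 0) * U 0 * (exp (C 1) * U 1) * (V 2 * exp (-(C 2))) * (V 3 * exp (-(C 3)))

/-- [folklore] THE PURE-EXPONENTIAL WORD `E := e^{c₁}e^{c₂}e^{−c₃}e^{−c₄}` of the transported exponents. -/
def expWord (U V C : Fin 4 → 𝔸) : 𝔸 :=
  exp (trExp₁ U V C) * exp (trExp₂ U V C) * exp (-(trExp₃ U V C)) * exp (-(trExp₄ U V C))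

end ExpWords
/-! ## §2 The transport identity `holRel = expWord · plaqBg` -/

section Transport

variable {𝔸 : Type*} [NormedRing 𝔸] [NormedAlgebra ℝ 𝔸] [CompleteSpace 𝔸]

variable {U V : Fin 4 → 𝔸}

/-- [folklore] **THE TRANSPORT IDENTITY**: with two-sided inverses `VᵢUᵢ = UᵢVᵢ = 1` the chart-point plaquette is the pure-exponential
word of the transported exponents times the background plaquette, `holRel U V C = expWord U V C · plaqBg U V`. -/
theorem expWord_mul_plaqBg (hUV : ∀ i, U i * V i = 1) (hVU : ∀ i, V i * U i = 1) (C : Fin 4 → 𝔸) :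
    expWord U V C * plaqBg U V = holRel U V C := by
  have hcU : ∀ i (x : 𝔸), U i * (V i * x) = x := fun i x => by rw [← mul_assoc, hUV i, one_mul]
  have hcV : ∀ i (x : 𝔸), V i * (U i * x) = x := fun i x => by rw [← mul_assoc, hVU i, one_mul]
  have hPPb : plaqBg U V * plaqBgInv U V = 1 := plaqBg_mul_plaqBgInv hUV hVU
  have hPbP : plaqBgInv U V * plaqBg U V = 1 := plaqBgInv_mul_plaqBg hUV hVU
  -- conjugation by a two-sided invertible passes through `exp` (Mathlib `exp_units_conj`, ℚ-structure restricted from ℝ;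
  -- the C⋆-algebra case is `B10Eq31GlobalConj.exp_conj_of_mul_eq_one`)
  letI : NormedAlgebra ℚ 𝔸 := NormedAlgebra.restrictScalars ℚ ℝ 𝔸
  have exp_conj_of_mul_eq_one : ∀ {P Q : 𝔸}, P * Q = 1 → Q * P = 1 → ∀ x : 𝔸, exp (P * x * Q) = P * exp x * Q :=
    fun hPQ hQP x => exp_units_conj ⟨_, _, hPQ, hQP⟩ x
  -- the three conjugations
  have h2 : exp (trExp₂ U V C) = U 0 * exp (C 1) * V 0 := exp_conj_of_mul_eq_one (hUV 0) (hVU 0) _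
  have h3 : exp (-(trExp₃ U V C)) = plaqBg U V * U 3 * exp (-(C 2)) * (V 3 * plaqBgInv U V) := by
    have e : -(trExp₃ U V C) = plaqBg U V * U 3 * (-(C 2)) * (V 3 * plaqBgInv U V) := by
      simp only [trExp₃]; noncomm_ring
    rw [e]
    refine exp_conj_of_mul_eq_one ?_ ?_ _
    · calc plaqBg U V * U 3 * (V 3 * plaqBgInv U V) = plaqBg U V * (U 3 * V 3) * plaqBgInv U V := by
            simp only [mul_assoc]
        _ = 1 := by rw [hUV 3, mul_one, hPPb]
    · calc V 3 * plaqBgInv U V * (plaqBg U V * U 3) = V 3 * (plaqBgInv U V * plaqBg U V) * U 3 := by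
            simp only [mul_assoc]
        _ = 1 := by rw [hPbP, mul_one, hVU 3]
  have h4 : exp (-(trExp₄ U V C)) = plaqBg U V * exp (-(C 3)) * plaqBgInv U V := by
    have e : -(trExp₄ U V C) = plaqBg U V * (-(C 3)) * plaqBgInv U V := by simp only [trExp₄]; noncomm_ring
    rw [e]
    exact exp_conj_of_mul_eq_one hPPb hPbP _
  simp only [expWord, trExp₁, h2, h3, h4, holRel]
  simp only [plaqBg, plaqBgInv, mul_assoc, hcU, hcV, hUV, mul_one]

end Transport

/-! ## §3 The estimate: first order in the curvature of the centre and in the covariant differences, quadratic in the amplitude -/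

section NormedRingHelpers

variable {𝔸 : Type*} [NormedRing 𝔸] {U V : Fin 4 → 𝔸}

/-- [folklore] A product of two elements of norm `≤ 1` has norm `≤ 1`. -/
theorem norm_mul_le_one {x y : 𝔸} (hx : ‖x‖ ≤ 1) (hy : ‖y‖ ≤ 1) : ‖x * y‖ ≤ 1 :=
  (norm_mul_le _ _).trans (by nlinarith [norm_nonneg x, norm_nonneg y])

/-- [folklore] `‖P‖ ≤ 1` for bond variables of norm `≤ 1`. -/
theorem norm_plaqBg_le_one (hU : ∀ i, ‖U i‖ ≤ 1) (hV : ∀ i, ‖V i‖ ≤ 1) : ‖plaqBg U V‖ ≤ 1 :=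
  norm_mul_le_one (norm_mul_le_one (norm_mul_le_one (hU 0) (hU 1)) (hV 2)) (hV 3)

/-- [folklore] `‖P̄‖ ≤ 1` for bond variables of norm `≤ 1`. -/
theorem norm_plaqBgInv_le_one (hU : ∀ i, ‖U i‖ ≤ 1) (hV : ∀ i, ‖V i‖ ≤ 1) : ‖plaqBgInv U V‖ ≤ 1 :=
  norm_mul_le_one (norm_mul_le_one (norm_mul_le_one (hU 3) (hU 2)) (hV 1)) (hV 0)

/-- [folklore] A conjugate `UxV` by elements of norm `≤ 1` has norm `≤ ‖x‖`. -/
theorem norm_conj_le {P Q x : 𝔸} (hP : ‖P‖ ≤ 1) (hQ : ‖Q‖ ≤ 1) : ‖P * x * Q‖ ≤ ‖x‖ := by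
  calc ‖P * x * Q‖ ≤ ‖P‖ * ‖x‖ * ‖Q‖ := (norm_mul_le _ _).trans (mul_le_mul_of_nonneg_right (norm_mul_le _ _) (norm_nonneg _))
    _ ≤ 1 * ‖x‖ * 1 := by gcongr
    _ = ‖x‖ := by ring

/-- [folklore] THE `Ad(P) − 1` DEFECT: `‖PxP̄ − x‖ ≤ 2‖P − 1‖·‖x‖` when `P̄P = 1` and `‖P̄‖ ≤ 1`
(`PxP̄ − x = (P − 1)xP̄ + xP̄(1 − P)`). -/
theorem norm_conj_sub_self_le {P Q x : 𝔸} (hQP : Q * P = 1) (hQ : ‖Q‖ ≤ 1) :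
    ‖P * x * Q - x‖ ≤ 2 * ‖P - 1‖ * ‖x‖ := by
  have e : P * x * Q - x = (P - 1) * x * Q + x * Q * (1 - P) := by
    have : x * Q * (1 - P) = x * Q - x * (Q * P) := by noncomm_ring
    rw [this, hQP]; noncomm_ring
  rw [e]
  have h1 : ‖(P - 1) * x * Q‖ ≤ ‖P - 1‖ * ‖x‖ := by
    calc ‖(P - 1) * x * Q‖ ≤ ‖P - 1‖ * ‖x‖ * ‖Q‖ :=
          (norm_mul_le _ _).trans (mul_le_mul_of_nonneg_right (norm_mul_le _ _) (norm_nonneg _))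
      _ ≤ ‖P - 1‖ * ‖x‖ * 1 := by gcongr
      _ = ‖P - 1‖ * ‖x‖ := mul_one _
  have h2 : ‖x * Q * (1 - P)‖ ≤ ‖P - 1‖ * ‖x‖ := by
    calc ‖x * Q * (1 - P)‖ ≤ ‖x‖ * ‖Q‖ * ‖1 - P‖ :=
          (norm_mul_le _ _).trans (mul_le_mul_of_nonneg_right (norm_mul_le _ _) (norm_nonneg _))
      _ ≤ ‖x‖ * 1 * ‖1 - P‖ := by gcongr
      _ = ‖P - 1‖ * ‖x‖ := by rw [norm_sub_rev]; ring
  calc ‖(P - 1) * x * Q + x * Q * (1 - P)‖ ≤ ‖(P - 1) * x * Q‖ + ‖x * Q * (1 - P)‖ := norm_add_le _ _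
    _ ≤ ‖P - 1‖ * ‖x‖ + ‖P - 1‖ * ‖x‖ := add_le_add h1 h2
    _ = 2 * ‖P - 1‖ * ‖x‖ := by ring

end NormedRingHelpers

section Estimate

variable {𝔸 : Type*} [NormedRing 𝔸] [NormedAlgebra ℝ 𝔸] [CompleteSpace 𝔸] {U V C : Fin 4 → 𝔸} {a δ ε : ℝ}

omit [NormedAlgebra ℝ 𝔸] [CompleteSpace 𝔸] in
/-- [folklore] **THE FIRST-ORDER TERM**: `‖c₁ + c₂ − c₃ − c₄‖ ≤ 2δ + 4aε` for amplitudes `‖Cᵢ‖ ≤ a`, covariant differences `≤ δ`,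
background plaquette `‖P − 1‖ ≤ ε`, bond variables of norm `≤ 1` and `P̄P = 1` (the curl identity `trExp_curl`). -/
theorem norm_trExp_curl_le (hU : ∀ i, ‖U i‖ ≤ 1) (hV : ∀ i, ‖V i‖ ≤ 1) (hPbP : plaqBgInv U V * plaqBg U V = 1)
    (hC : ∀ i, ‖C i‖ ≤ a) (hD₁ : ‖covDiff₁ U V C‖ ≤ δ) (hD₂ : ‖covDiff₂ U V C‖ ≤ δ) (hP : ‖plaqBg U V - 1‖ ≤ ε) :
    ‖trExp₁ U V C + trExp₂ U V C - trExp₃ U V C - trExp₄ U V C‖ ≤ 2 * δ + 4 * a * ε := by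
  have hPb1 := norm_plaqBgInv_le_one hU hV
  have hP1 := norm_plaqBg_le_one hU hV
  have hε : 0 ≤ ε := (norm_nonneg _).trans hP
  have hdef : ∀ x : 𝔸, ‖x - plaqBg U V * x * plaqBgInv U V‖ ≤ 2 * ε * ‖x‖ := fun x => by
    rw [norm_sub_rev]
    exact (norm_conj_sub_self_le hPbP hPb1).trans (by gcongr)
  rw [trExp_curl]
  calc ‖(C 0 - plaqBg U V * C 0 * plaqBgInv U V) + (C 3 - plaqBg U V * C 3 * plaqBgInv U V) + covDiff₂ U V C -
          plaqBg U V * covDiff₁ U V C * plaqBgInv U V‖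
        ≤ ‖C 0 - plaqBg U V * C 0 * plaqBgInv U V‖ + ‖C 3 - plaqBg U V * C 3 * plaqBgInv U V‖ + ‖covDiff₂ U V C‖ +
          ‖plaqBg U V * covDiff₁ U V C * plaqBgInv U V‖ :=
          (norm_sub_le _ _).trans (add_le_add ((norm_add_le _ _).trans (add_le_add (norm_add_le _ _) le_rfl)) le_rfl)
    _ ≤ 2 * ε * ‖C 0‖ + 2 * ε * ‖C 3‖ + δ + δ :=
          add_le_add (add_le_add (add_le_add (hdef _) (hdef _)) hD₂) ((norm_conj_le hP1 hPb1).trans hD₁)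
    _ ≤ 2 * ε * a + 2 * ε * a + δ + δ := by gcongr <;> simp [hC]
    _ = 2 * δ + 4 * a * ε := by ring

/-- [folklore] **THE PURE-EXPONENTIAL WORD**: `‖expWord − 1‖ ≤ 2δ + 4aε + (e^{4a} − 1 − 4a)` — `T4SegmentCurvature`'s first-order bound for
ordered products of exponentials on the transported word (each transported exponent has norm `≤ a`), plus `norm_trExp_curl_le`. -/
theorem norm_expWord_sub_one_le (hU : ∀ i, ‖U i‖ ≤ 1) (hV : ∀ i, ‖V i‖ ≤ 1) (hPbP : plaqBgInv U V * plaqBg U V = 1)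
    (hC : ∀ i, ‖C i‖ ≤ a) (hD₁ : ‖covDiff₁ U V C‖ ≤ δ) (hD₂ : ‖covDiff₂ U V C‖ ≤ δ) (hP : ‖plaqBg U V - 1‖ ≤ ε) :
    ‖expWord U V C - 1‖ ≤ 2 * δ + 4 * a * ε + (Real.exp (4 * a) - 1 - 4 * a) := by
  have hPb1 := norm_plaqBgInv_le_one hU hV
  have hP1 := norm_plaqBg_le_one hU hV
  -- the transported exponents have norm ≤ a
  have h1 : ‖trExp₁ U V C‖ ≤ a := hC 0
  have h2 : ‖trExp₂ U V C‖ ≤ a := (norm_conj_le (hU 0) (hV 0)).trans (hC 1)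
  have h3 : ‖trExp₃ U V C‖ ≤ a :=
    (norm_conj_le (norm_mul_le_one hP1 (hU 3)) (norm_mul_le_one (hV 3) hPb1)).trans (hC 2)
  have h4 : ‖trExp₄ U V C‖ ≤ a := (norm_conj_le hP1 hPb1).trans (hC 3)
  -- first-order bound on the ordered product
  have h := norm_prod_exp_sub_one_le_first_order (𝔸 := 𝔸)
    [trExp₁ U V C, trExp₂ U V C, -(trExp₃ U V C), -(trExp₄ U V C)]
  have hprod : (([trExp₁ U V C, trExp₂ U V C, -(trExp₃ U V C), -(trExp₄ U V C)] : List 𝔸).map exp).prod =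
      expWord U V C := by
    simp [expWord, mul_assoc]
  have hsum : ([trExp₁ U V C, trExp₂ U V C, -(trExp₃ U V C), -(trExp₄ U V C)] : List 𝔸).sum =
      trExp₁ U V C + trExp₂ U V C - trExp₃ U V C - trExp₄ U V C := by
    simp only [List.sum_cons, List.sum_nil, add_zero]; abel
  set T := (([trExp₁ U V C, trExp₂ U V C, -(trExp₃ U V C), -(trExp₄ U V C)] : List 𝔸).map (‖·‖)).sum with hTdef
  have hT : T = ‖trExp₁ U V C‖ + ‖trExp₂ U V C‖ + ‖trExp₃ U V C‖ + ‖trExp₄ U V C‖ := by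
    simp only [hTdef, List.map_cons, List.map_nil, List.sum_cons, List.sum_nil, norm_neg]; ring
  have hT0 : 0 ≤ T := by rw [hT]; positivity
  have hT4 : T ≤ 4 * a := by rw [hT]; linarith
  have hmono : Real.exp T - 1 - T ≤ Real.exp (4 * a) - 1 - 4 * a := exp_sub_one_sub_mono hT0 hT4
  rw [hprod, hsum] at h
  exact h.trans (add_le_add (norm_trExp_curl_le hU hV hPbP hC hD₁ hD₂ hP) hmono)

/-- **THE ELEMENTARY INEQUALITY OF [I] (3.43) WITH A UNITARY BACKGROUND** (the point of the module).  For bond variables with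
two-sided inverses and norms `≤ 1` (unitaries), chart exponents of amplitude `‖Cᵢ‖ ≤ a`, covariant differences `‖covDiffᵢ‖ ≤ δ` and
background plaquette `‖P − 1‖ ≤ ε`:  `‖holRel − 1‖ ≤ ε + 2δ + 4aε + (e^{4a} − 1 − 4a)`.  KIND [Balaban1987RG1] p. 278 «From the bounds
in (3.37), and an elementary inequality, we get …(3.43)»; nothing of the series asserted. [cite: Balaban1987RG1, (3.43) p.278] -/
theorem norm_holRel_sub_one_le (hU : ∀ i, ‖U i‖ ≤ 1) (hV : ∀ i, ‖V i‖ ≤ 1) (hUV : ∀ i, U i * V i = 1)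
    (hVU : ∀ i, V i * U i = 1) (hC : ∀ i, ‖C i‖ ≤ a) (hD₁ : ‖covDiff₁ U V C‖ ≤ δ) (hD₂ : ‖covDiff₂ U V C‖ ≤ δ)
    (hP : ‖plaqBg U V - 1‖ ≤ ε) :
    ‖holRel U V C - 1‖ ≤ ε + (2 * δ + 4 * a * ε + (Real.exp (4 * a) - 1 - 4 * a)) := by
  have hPbP := plaqBgInv_mul_plaqBg (U := U) (V := V) hUV hVU
  have hE := norm_expWord_sub_one_le hU hV hPbP hC hD₁ hD₂ hP
  have hP1 := norm_plaqBg_le_one hU hV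
  rw [← expWord_mul_plaqBg hUV hVU C]
  have e : expWord U V C * plaqBg U V - 1 = (expWord U V C - 1) * plaqBg U V + (plaqBg U V - 1) := by noncomm_ring
  rw [e]
  calc ‖(expWord U V C - 1) * plaqBg U V + (plaqBg U V - 1)‖
        ≤ ‖expWord U V C - 1‖ * ‖plaqBg U V‖ + ‖plaqBg U V - 1‖ :=
          (norm_add_le _ _).trans (add_le_add (norm_mul_le _ _) le_rfl)
    _ ≤ (2 * δ + 4 * a * ε + (Real.exp (4 * a) - 1 - 4 * a)) * 1 + ε := by
          gcongr
          exact (norm_nonneg _).trans hE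
    _ = ε + (2 * δ + 4 * a * ε + (Real.exp (4 * a) - 1 - 4 * a)) := by ring

end Estimate

/-! ## §4 In print's letters: the `ξ²`-bound and the displayed budget for clause (iii) -/

section Print

variable {𝔸 : Type*} [NormedRing 𝔸] [NormedAlgebra ℝ 𝔸] [CompleteSpace 𝔸] {U V C : Fin 4 → 𝔸}

/-- HYPOTHESIS SHAPE **`CondIIIBudget α₀ α′₀ α₁ a′`** — THE BUDGET FOR CLAUSE (iii) ON THE WEIGHTED RELATIVE CHART (S-class scalar,
DISPLAYED — the inequality the substrate typer's (λ8) asks an owner to display in print's letters): `α′₀·(1 + 4α₁) + 2a′ + 16α₁² ≤ α₀`,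
where `α′₀` is the centre's curvature constant ([Balaban1987RG1] (1.11) p. 262), `α₁` the amplitude and `a′` the covariant-difference
constant of the complex coordinate ((1.13)), `α₀` the target of (1.14).  Its members mirror print's mechanisms (KIND only): enlargement
(3.41)∕(3.47), derivative control (3.44)–(3.46), and the restriction after (3.43) p. 278 «(4B₃²O(1)M)²α₀ ≤ β» (quadratic in the
amplitude).  READING GUARD (C-ne9leaf03g22-1 INFO-4): at print's own letters `CondIIIBudget α₀ α₀ α₁ α₁` forces `α₁ = 0` — the budget
places a WEIGHTED relative SUB-ball (slack in the centre, `a′ ≤ α₀∕2`, `ρ₀² ≲ α₀`) inside (ii) ∩ (iii); it is NOT «(ii) ⇒ (iii)».  A cell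
predicate, never adjudicated here; nothing printed is asserted. [folklore] -/
def CondIIIBudget (α₀ α₀' α₁ a' : ℝ) : Prop :=
  α₀' * (1 + 4 * α₁) + 2 * a' + 16 * α₁ ^ 2 ≤ α₀

/-- [folklore] **THE `ξ²`-BOUND**: with `ε = α′₀ξ²`, `a = ξα₁`, `δ = ξ²a′`, `0 < ξ ≤ 1` and `4α₁ ≤ 1`,
`‖holRel − 1‖ ≤ ξ²·(α′₀(1 + 4ξα₁) + 2a′ + 16α₁²)` — uniform in the lattice spacing `ξ`: the `ξ²` of a curvature bound comes from the
background's own `ξ²`, from the covariant differences (one `ξ` from the chart scale, one from the difference quotient), and from the SQUARE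
of the amplitude `ξα₁`. -/
theorem norm_holRel_sub_one_le_xi_sq {ξ α₀' α₁ a' : ℝ} (hξ0 : 0 < ξ) (hξ1 : ξ ≤ 1) (hα₁ : 4 * α₁ ≤ 1)
    (hU : ∀ i, ‖U i‖ ≤ 1) (hV : ∀ i, ‖V i‖ ≤ 1) (hUV : ∀ i, U i * V i = 1) (hVU : ∀ i, V i * U i = 1)
    (hC : ∀ i, ‖C i‖ ≤ ξ * α₁) (hD₁ : ‖covDiff₁ U V C‖ ≤ ξ ^ 2 * a') (hD₂ : ‖covDiff₂ U V C‖ ≤ ξ ^ 2 * a')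
    (hP : ‖plaqBg U V - 1‖ ≤ α₀' * ξ ^ 2) :
    ‖holRel U V C - 1‖ ≤ ξ ^ 2 * (α₀' * (1 + 4 * ξ * α₁) + 2 * a' + 16 * α₁ ^ 2) := by
  have h := norm_holRel_sub_one_le hU hV hUV hVU hC hD₁ hD₂ hP
  have ha0 : 0 ≤ ξ * α₁ := (norm_nonneg _).trans (hC 0)
  have hα₁0 : 0 ≤ α₁ := nonneg_of_mul_nonneg_right ha0 hξ0
  -- the quadratic regime: e^{4a} − 1 − 4a ≤ (4a)² for 0 ≤ 4a ≤ 1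
  have h4a1 : 4 * (ξ * α₁) ≤ 1 := by nlinarith
  have hq : Real.exp (4 * (ξ * α₁)) - 1 - 4 * (ξ * α₁) ≤ (4 * (ξ * α₁)) ^ 2 := by
    have h0 : 0 ≤ 4 * (ξ * α₁) := by positivity
    have := Real.abs_exp_sub_one_sub_id_le (x := 4 * (ξ * α₁)) (by rwa [abs_of_nonneg h0])
    exact (le_abs_self _).trans this
  have hsq : (4 * (ξ * α₁)) ^ 2 ≤ ξ ^ 2 * (16 * α₁ ^ 2) := by nlinarith
  calc ‖holRel U V C - 1‖
        ≤ α₀' * ξ ^ 2 + (2 * (ξ ^ 2 * a') + 4 * (ξ * α₁) * (α₀' * ξ ^ 2) +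
          (Real.exp (4 * (ξ * α₁)) - 1 - 4 * (ξ * α₁))) := h
    _ ≤ α₀' * ξ ^ 2 + (2 * (ξ ^ 2 * a') + 4 * (ξ * α₁) * (α₀' * ξ ^ 2) + ξ ^ 2 * (16 * α₁ ^ 2)) := by
          gcongr; exact hq.trans hsq
    _ = ξ ^ 2 * (α₀' * (1 + 4 * ξ * α₁) + 2 * a' + 16 * α₁ ^ 2) := by ring

/-- **CLAUSE (iii) FOR THE WEIGHTED RELATIVE CHART UNDER THE DISPLAYED BUDGET**: with the letters of `norm_holRel_sub_one_le_xi_sq`, a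
centre of curvature constant `α′₀ ≥ 0` and `CondIIIBudget α₀ α′₀ α₁ a′`, the chart-point plaquette obeys print's absolute clause
`‖holRel − 1‖ ≤ α₀ξ²` ((1.14)) — the RELATIVE set {amplitude `≤ ξα₁`, covariant differences `≤ ξ²a′`} around a centre satisfying (1.11)
with `α′₀` lies inside clause (iii); (ii) holds on it by inspection of (1.13); (iv) is print's p. 263 ¶2 (T, displayed elsewhere).
[cite: Balaban1987RG1, (1.11)-(1.14) p.262] -/
theorem norm_holRel_sub_one_le_of_budget {ξ α₀ α₀' α₁ a' : ℝ} (hξ0 : 0 < ξ) (hξ1 : ξ ≤ 1) (hα₁ : 4 * α₁ ≤ 1) (hα₀' : 0 ≤ α₀')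
    (hB : CondIIIBudget α₀ α₀' α₁ a')
    (hU : ∀ i, ‖U i‖ ≤ 1) (hV : ∀ i, ‖V i‖ ≤ 1) (hUV : ∀ i, U i * V i = 1) (hVU : ∀ i, V i * U i = 1)
    (hC : ∀ i, ‖C i‖ ≤ ξ * α₁) (hD₁ : ‖covDiff₁ U V C‖ ≤ ξ ^ 2 * a') (hD₂ : ‖covDiff₂ U V C‖ ≤ ξ ^ 2 * a')
    (hP : ‖plaqBg U V - 1‖ ≤ α₀' * ξ ^ 2) :
    ‖holRel U V C - 1‖ ≤ α₀ * ξ ^ 2 := by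
  have h := norm_holRel_sub_one_le_xi_sq hξ0 hξ1 hα₁ hU hV hUV hVU hC hD₁ hD₂ hP
  have hα₁0 : 0 ≤ α₁ := by
    have ha0 : 0 ≤ ξ * α₁ := (norm_nonneg _).trans (hC 0)
    exact nonneg_of_mul_nonneg_right ha0 hξ0
  have hmid : α₀' * (1 + 4 * ξ * α₁) + 2 * a' + 16 * α₁ ^ 2 ≤ α₀ := by
    have : α₀' * (1 + 4 * ξ * α₁) ≤ α₀' * (1 + 4 * α₁) := by
      apply mul_le_mul_of_nonneg_left _ hα₀'; nlinarith
    unfold CondIIIBudget at hB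
    linarith
  calc ‖holRel U V C - 1‖ ≤ ξ ^ 2 * (α₀' * (1 + 4 * ξ * α₁) + 2 * a' + 16 * α₁ ^ 2) := h
    _ ≤ ξ ^ 2 * α₀ := mul_le_mul_of_nonneg_left hmid (by positivity)
    _ = α₀ * ξ ^ 2 := mul_comm _ _

/-- [folklore] A budget instance (orientation only, NOT print's constants): `α′₀ ≤ α₀∕4`, `a′ ≤ α₀∕8`, `α₁² ≤ α₀∕64`, `α₁ ≤ 1∕4`. -/
theorem condIIIBudget_of_split {α₀ α₀' α₁ a' : ℝ} (hα₀' : 0 ≤ α₀') (h0 : α₀' ≤ α₀ / 4) (h1 : a' ≤ α₀ / 8)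
    (h2 : α₁ ^ 2 ≤ α₀ / 64) (h3 : α₁ ≤ 1 / 4) : CondIIIBudget α₀ α₀' α₁ a' := by
  unfold CondIIIBudget
  nlinarith [mul_le_mul_of_nonneg_left h3 hα₀']

end Print

end Summit.QuantumFields.BalabanUV.T4Continuum.NE9RelativeChartPlaquette
end
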